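import Summits.Ventures.QEC.Census.CertBZPlaneMixed
import HarnessLib

/-!
# Lane engine: ADAPTIVE top-row split trees (generic glue over qec-search-5's `topOK` families; qec-search-9 g5)

`Census/CertBZPlaneMixed.lean` (`reaches_of_segsTops`) replays a Brouwer–Zimmermann matrix `G` (`K` rows) by largest-row
segments below a cut `c` and ONE `topOK` family per subset `P` of the `k = K − c` top rows. For a depth-`8` enumeration of a
`48`-row matrix met by tens of thousands of allow-listed words (the level-1 list of a cover certificate, e.g. `[[192,4,18]]`:
`5.5·10⁸` selections, `≈ 6·10⁴` straggler visits) no single cut works: a small `k` leaves top families of `> 10⁷` lanes (over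
the engine's per-declaration memory), a large `k` needs `> 10⁵` families. This file lets the cut VARY along the branch:
a binary split tree decides the top rows one at a time (row `c−1` selected / not selected) and stops at any node, whose
family is `topFamily c (T − |P|) (K − c) P` — all completions below the current cut `c` of the fixed selected top rows `P`.
Vocabulary (spelled out in each statement, no new definition): «CutOK(c, P)» = the leaf `bzLeaf wmax allow` holds at every
strictly increasing selection `J` of `≤ T` rows of `G` whose rows `≥ c` are exactly `P`. Three lemmas assemble any such tree
WITHOUT re-evaluating a family:
* `cutOK_of_topOK`  — a passing `topOK n wmax allow G c (T − |P|) (|G| − c) P fuel` gives CutOK(c, P) (leaf);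
* `cutOK_succ`      — CutOK(c, c :: P) and CutOK(c, P) give CutOK(c+1, P) (split on row `c`);
* `reaches_of_cutOK` — CutOK(|G|, []) gives `Reaches (bzLeaf wmax allow) (rowPos G 0) T 0 0`, the conclusion of
  `reaches_of_segList` / `reaches_of_segsTops`, so every consumer applies verbatim (`CertBZList.mem_allow_of_struct_reaches`, …).
HONEST FRAMING: generic glue, theorems only; no check is restated or weakened, no certificate is read, no
distance is asserted; axioms ⊆ {propext, Classical.choice, Quot.sound}.
-/

set_option autoImplicit false

namespace Summit.Ventures.QEC.Census.Plane

open List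

/-- The part `≥ c` of a strictly increasing list containing `c` is `c` followed by the part `≥ c+1`. -/
theorem filter_le_eq_cons_of_mem (c : ℕ) : ∀ J : List ℕ, J.Pairwise (· < ·) → c ∈ J →
    (J.filter fun j => decide (c ≤ j)) = c :: J.filter fun j => decide (c + 1 ≤ j)
  | [], _, h => absurd h List.not_mem_nil
  | a :: J', hp, hc => by
    rw [List.pairwise_cons] at hp
    rcases List.mem_cons.1 hc with rfl | hc'
    · rw [List.filter_cons_of_pos (by simp), List.filter_cons_of_neg (by simp)]
      congr 1
      exact List.filter_congr fun j hj => by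
        have := hp.1 j hj
        by_cases h : c + 1 ≤ j
        · simp [h, show c ≤ j by omega]
        · simp [h, show ¬ c ≤ j by omega]
    · have hac : a < c := hp.1 c hc'
      rw [List.filter_cons_of_neg (by simpa using hac), List.filter_cons_of_neg (by simp; omega)]
      exact filter_le_eq_cons_of_mem c J' hp.2 hc'

/-- The part `≥ c` of a list avoiding `c` is its part `≥ c+1`. -/
theorem filter_le_eq_of_not_mem (c : ℕ) (J : List ℕ) (hc : c ∉ J) :
    (J.filter fun j => decide (c ≤ j)) = J.filter fun j => decide (c + 1 ≤ j) :=
  List.filter_congr fun j hj => by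
    have hne : j ≠ c := fun h => hc (h ▸ hj)
    by_cases h : c + 1 ≤ j
    · simp [h, show c ≤ j by omega]
    · simp [h, show ¬ c ≤ j by omega]

variable (n wmax : ℕ) (allow G : List ℕ) (T : ℕ)

/-- **Leaf.** A passing top family with cut `c`, fixed top rows `P` (all `≥ c`), budget `T − |P|` over the `|G| − c` top rows
gives CutOK(c, P) (the rows of `G` are words below `2^n`). -/
theorem cutOK_of_topOK (hG : ∀ g ∈ G, g < 2 ^ n) {c : ℕ} {P : List ℕ} {fuel : ℕ} (hc : c ≤ G.length)
    (hok : topOK n wmax allow G c (T - P.length) (G.length - c) P fuel = true) :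
    (∀ J : List ℕ, J.Pairwise (· < ·) → (∀ j ∈ J, j < G.length) → J.length ≤ T →
      (J.filter fun j => decide (c ≤ j)) = P →
      bzLeaf wmax allow (xorFst (J.map fun j => (2 ^ j, G.getD j 0))) (xorSnd (J.map fun j => (2 ^ j, G.getD j 0))) = true) := by
  intro J hJp hJlt hJl hJP
  set J1 := J.filter fun j => decide (j < c) with hJ1
  have hJ1c : ∀ j ∈ J1, j < c := fun j hj => by simpa using (List.mem_filter.1 hj).2
  have hPc : ∀ p ∈ P, c ≤ p ∧ p < c + (G.length - c) := fun p hp => by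
    rw [← hJP] at hp
    obtain ⟨hpJ, hpc⟩ := List.mem_filter.1 hp
    have := hJlt p hpJ
    exact ⟨by simpa using hpc, by omega⟩
  have hJ1p : J1.Pairwise (· < ·) := hJp.filter _
  have hlenJ : J1.length + P.length = J.length := by
    have e2 : ∀ j : ℕ, (!decide (j < c)) = decide (c ≤ j) := fun j => by
      by_cases h : j < c
      · simp [h, Nat.not_le.2 h]
      · simp [h, Nat.not_lt.1 h]
    have h := List.length_eq_length_filter_add (fun j => decide (j < c)) (l := J)
    rw [List.filter_congr (fun j _ => e2 j), hJP] at h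
    rw [hJ1]; exact h.symm
  rw [topOK] at hok
  have hmem : ∀ i, (i ∈ J1 ++ P) ↔ i ∈ J := fun i => by
    rw [List.mem_append, hJ1, ← hJP, List.mem_filter, List.mem_filter]
    constructor
    · rintro (⟨h, -⟩ | ⟨h, -⟩) <;> exact h
    · intro h; by_cases hic : i < c
      · exact Or.inl ⟨h, by simpa using hic⟩
      · exact Or.inr ⟨h, by simpa using Nat.not_lt.1 hic⟩
  obtain ⟨b, hb, hbits⟩ := covers_topFamily c (T - P.length) (G.length - c) P hPc J1 hJ1p hJ1c (by omega)
  have hbits' : ∀ i, ((topFamily c (T - P.length) (G.length - c) P).2.getD i 0).testBit b = decide (i ∈ J) :=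
    fun i => by rw [hbits i]; exact Bool.decide_congr (hmem i)
  exact leaf_of_familyOK_covers n wmax allow G fuel hG _ hok J hJp hJlt hb hbits'

/-- **Split on row `c`.** If the selections whose rows `≥ c` are `c :: P` and those whose rows `≥ c` are `P` are all fine,
then so is every selection whose rows `≥ c + 1` are `P`. -/
theorem cutOK_succ {c : ℕ} {P : List ℕ}
    (hsel : (∀ J : List ℕ, J.Pairwise (· < ·) → (∀ j ∈ J, j < G.length) → J.length ≤ T →
      (J.filter fun j => decide (c ≤ j)) = c :: P →
      bzLeaf wmax allow (xorFst (J.map fun j => (2 ^ j, G.getD j 0))) (xorSnd (J.map fun j => (2 ^ j, G.getD j 0))) = true))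
    (hskip : (∀ J : List ℕ, J.Pairwise (· < ·) → (∀ j ∈ J, j < G.length) → J.length ≤ T →
      (J.filter fun j => decide (c ≤ j)) = P →
      bzLeaf wmax allow (xorFst (J.map fun j => (2 ^ j, G.getD j 0))) (xorSnd (J.map fun j => (2 ^ j, G.getD j 0))) = true)) :
    (∀ J : List ℕ, J.Pairwise (· < ·) → (∀ j ∈ J, j < G.length) → J.length ≤ T →
      (J.filter fun j => decide (c + 1 ≤ j)) = P →
      bzLeaf wmax allow (xorFst (J.map fun j => (2 ^ j, G.getD j 0))) (xorSnd (J.map fun j => (2 ^ j, G.getD j 0))) = true) := by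
  intro J hJp hJlt hJl hJP
  by_cases hc : c ∈ J
  · exact hsel J hJp hJlt hJl (by rw [filter_le_eq_cons_of_mem c J hJp hc, hJP])
  · exact hskip J hJp hJlt hJl (by rw [filter_le_eq_of_not_mem c J hc, hJP])

/-- **Root.** CutOK at the cut `|G|` with no top rows is the replay statement: `bzLeaf wmax allow` holds at every
sub-selection of `≤ T` rows of `G`. -/
theorem reaches_of_cutOK
    (h : (∀ J : List ℕ, J.Pairwise (· < ·) → (∀ j ∈ J, j < G.length) → J.length ≤ T →
      (J.filter fun j => decide (G.length ≤ j)) = [] →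
      bzLeaf wmax allow (xorFst (J.map fun j => (2 ^ j, G.getD j 0))) (xorSnd (J.map fun j => (2 ^ j, G.getD j 0))) = true)) :
    Reaches (bzLeaf wmax allow) (rowPos G 0) T 0 0 := by
  intro S hS hSl
  rw [Nat.zero_xor, Nat.zero_xor]
  obtain ⟨J, hJsub, rfl⟩ := exists_map_of_sublist_rowPos G hS
  have hJp : J.Pairwise (· < ·) := List.Pairwise.sublist hJsub List.pairwise_lt_range
  have hJlt : ∀ j ∈ J, j < G.length := fun j hj => List.mem_range.1 (hJsub.subset hj)
  rw [List.length_map] at hSl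
  refine h J hJp hJlt hSl (List.filter_eq_nil_iff.2 fun j hj => ?_)
  simpa using hJlt j hj

/-! ## Control (the Steane matrix of `Census/CertBZPlaneTop.lean`: 4 rows of 7 bits, threshold `wmax = 2`, budget `T = 2`) -/

/-- Control (a statement not in the tree: budget `T = 3`): an adaptive tree — split on row `3`, then on row `2` only in
the branch where row `3` is NOT selected; leaves `(3, [3])` (row 3 with `≤ 2` more below it), `(2, [2])`, `(2, [])` — every
selection of `≤ 3` of the 4 Steane rows has weight `≥ 3` (threshold `wmax = 2`). -/
theorem reaches_steane_tree : Reaches (bzLeaf 2 []) (rowPos steaneG 0) 3 0 0 :=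
  reaches_of_cutOK 2 [] steaneG 3
    (cutOK_succ 2 [] steaneG 3
      (cutOK_of_topOK 7 2 [] steaneG 3 (by decide) (c := 3) (P := [3]) (fuel := 1) (by decide) (by decide))
      (cutOK_succ 2 [] steaneG 3
        (cutOK_of_topOK 7 2 [] steaneG 3 (by decide) (c := 2) (P := [2]) (fuel := 1) (by decide) (by decide))
        (cutOK_of_topOK 7 2 [] steaneG 3 (by decide) (c := 2) (P := []) (fuel := 1) (by decide) (by decide))))

/-- Control (negative): with the bar raised to `wmax = 4` the leaf family `(2, [])` (all pairs among rows `0, 1`) FAILS —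
the weight-4 sums are not allow-listed. -/
theorem topOK_steane_tree_neg : topOK 7 4 [] steaneG 2 2 2 [] 3 = false := by decide

end Summit.Ventures.QEC.Census.Plane
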